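import Literature.MathematicalPhysics.QuantumFieldTheory.Balaban1983to89.T4DirectionChart
import Literature.MathematicalPhysics.QuantumFieldTheory.Balaban1983to89.T4BackgroundDeviation

/-!
# T4BackgroundDeviationChart — the background-deviation input `BgDev` FROM THE DIRECTION CHART of
# `T4DirectionChart`: one chart, both first-order inputs of NE1′'s (α)/(γ) nodes
# (cell `pub-balaban`, T4-DAG v14 row T4-O3.E-i-α-BGDEV-CHART°, carved from the pv04 lineage's proposal; lineage pv04
# = one-writer of `T4BackgroundDeviation`; bookkeeping only — a binder-merging inside NE1′, NOT an estimate)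

HONEST FRAMING (cell `pub-balaban`, T4-DAG v14).  The cell's T4 target is the existence AND uniqueness of the continuum
limit of Bałaban's unit-scale averaged loop expectations on a finite torus — NOT the Yang–Mills mass gap, NOT the Clay
problem, and NOT claimed.  This module is ELEMENTARY BOOKKEEPING joining two siblings BY NAME; it proves nothing about
Bałaban's objects and reads no page:
* `T4DirectionChart` (row T4-O3.E-i′-Oβ3-RECHART*) types the normed-algebra skeleton of [I] §3's direction chart
  `𝐔′ = exp(iξ𝐀)U₀` around a NON-FLAT G-valued base — the tube `dirTube` ((C1)–(C4)), its disc inclusion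
  `closedBall_subset_dirTube`, the configuration-level chart `dirConfig ξ A U s = (i ↦ exp(iξs·A i)·U i)` (entire in
  `s`) — and derives the (β)/(γ) nodes' MEAN-FIELD MODULUS `T4FirstOrderSize.MeanLipschitz dom m S u₀ dev (4B/α₁′)`
  from ONE analytic hypothesis (a functional `Mc` complex differentiable and bounded by `B` on a class `𝒞` of link
  configurations containing the chart images of the tube): `meanLipschitz_chart(_of_class)`.
* `T4BackgroundDeviation` (row T4-O3.E-i-α-BGDEV*) types the (α) node's BACKGROUND-DEVIATION input
  `BgDev s vΛ dom u₀ dev L` (`dist1((vΛ u₀ b)⁻¹·vΛ u b) ≤ L·dev u` on `dom`, bondwise on `s`) and its analytic supplier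
  in `U(n)`/`SU(n)`, `bgDev_of_segment(_SU)`: the two backgrounds are the endpoints of a matrix-valued slice complex
  differentiable and bounded by `B` on a set containing the closed discs of radius `α₁/dev u` about `[0, 1]`
  ⇒ `BgDev … (4B/α₁)` (Cauchy along the segment, `T4AxialChain.norm_sub_le_of_segment`).
The two segment lemmas share the binder shape `∃ g D, g 0 = … ∧ g 1 = … ∧ DifferentiableOn ℂ g D ∧ (∀ z ∈ D, ‖g z‖ ≤ B)
∧ ∀ t ∈ [0, 1], closedBall t (α₁/dev u) ⊆ D`.  WHAT IS TYPED HERE is the background-deviation analogue of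
`meanLipschitz_chart(_of_class)` — the SAME chart data (base `U : ι → 𝔸ˣ` of G-valued units, base curvature
`≤ δ_bξ²` on `plaq`, `δ_b ≤ α₀/2`, per exterior `u ∈ dom` a direction `A u` with gauge `0 ≤ N u ≤ dev u`,
`‖A u i‖ ≤ N u`, covariant plaquette sums `≤ 2ξ·N u`, the chart condition `dev u + α₁′ ≤ α₀/8`, `≤ t`), the disc
inclusion supplied by `closedBall_subset_dirTube`, and ONE MORE analytic hypothesis of the same kind (a MATRIX-valued
background functional `Vc` on the same class `𝒞`, bounded by `B_V`) — giving `BgDev s vΛ dom u₀ dev (4B_V/α₁′)`: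
* §1 [bookkeeping] `bgDev_chart` / `bgDev_chart_SU` (tube level: the slice is given ON THE TUBE of the chart, verbatim
  the `hleaf` of `meanLipschitz_chart`) and `bgDev_chart_of_class` / `bgDev_chart_of_class_SU` (configuration level:
  `Vc` complex differentiable and bounded by `B_V` — bondwise on `s` — on `𝒞 ∋ dirConfig ξ (A u) U z` for `z` in the
  tube of `u`, with `(vΛ u b : M_n(ℂ)) = Vc (dirConfig ξ (A u) U 1) b` — the exterior `u ∈ dom` IS the chart point —
  and `(vΛ u₀ b : M_n(ℂ)) = Vc (baseConfig U) b` — the reference exterior IS the base).  The degenerate clause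
  `dev u = 0` needs NO hypothesis: `N u = 0` forces `A u = 0`, the chart point is the base
  (`T4DirectionChart.dirConfig_eq_base_of_eq_zero`), and the two backgrounds agree as group elements (`Subtype.ext`).
  The algebra `𝔸` carrying base and direction is ANY complete normed `ℂ`-algebra (only the background's values are
  matrices); §3 is the dictionary for the intended instance `𝔸 = M_n(ℂ)`.
* §2 [bookkeeping] ONE CHART, BOTH FIRST-ORDER INPUTS: `chart_supplies_both(_SU)` — the same chart data with two
  functionals on the same class, `Mc` (the insert's conditional mean, values in a complete complex normed space `F`,
  bounded by `B`) and `Vc` (the background, bounded by `B_V`), give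
  `MeanLipschitz dom m S u₀ dev (4B/α₁′) ∧ BgDev s vΛ dom u₀ dev (4B_V/α₁′)`; with `MeanVanishes` at the base AS A
  NAMED HYPOTHESIS also `CondMeanSuppression dom m S dev (4B/α₁′) ∧ BgDev …` (`chart_supplies_both_condMean(_SU)`).
  These are the two hypotheses — the mean-field modulus and `hbg : BgDev …` — that the (α)/(β) consumers read
  (`T4TiltModulusRelative`, `T4TiltOscillationRel`, and the sizing leaf `T4RelativeTiltSize.reps_le_tiltSlope_mul_dev`
  of row T4-O3.E-iii-b-G7-RELSIZE°), so that for the FIRST-ORDER inputs the «hidden-k» question of GAPS G-pv28g6-1″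
  reduces to ONE analytic hypothesis family (the class `𝒞`, the bounds `B`, `B_V`, the width `α₁′`, the chart
  constants) on ONE printed chart, instead of two unrelated slices.  Changes no count of the T4-DAG.
* §3 [folklore] THE DICTIONARY FOR A UNITARY BASE (`𝔸 = M_n(ℂ)` with the L²-operator norm of the cell's
  `UnitaryModel`): a unitary matrix read as a unit of `M_n(ℂ)` through Mathlib's `Unitary.toUnits` is a G-valued unit
  of the chart (`gUnit_toUnits`, `gUnit_toUnits_SU`: `‖u‖ ≤ 1` and `‖u⁻¹‖ ≤ 1`), and the base configuration of such
  units is the underlying matrix configuration (`baseConfig_toUnits`) — so a `U(n)`/`SU(n)`-valued base discharges the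
  chart's `hU : ∀ i, GUnit (U i)` (`gUnit_base`).
* §4 [folklore] THE BASE HYPOTHESIS, STATED (T4-DAG v14 §8 Q22, which the row asks its taker to answer).  The `BgDev`
  conclusions of §1/§2 consume NO hypothesis at the base: the background deviation is RELATIVE BY CONSTRUCTION — its
  zeroth-order term `dist1((vΛ u₀ b)⁻¹·vΛ u₀ b)` is `0` identically (`dist1_base_term`, `bgDev_singleton_base`), so
  NONE of Q22 (i)–(iii) is used for the (α) background input, at a flat or at a non-flat base alike.  The
  conditional-mean suppression of §2 carries `h0 : MeanVanishes S (m u₀)` as a NAMED BINDER — Q22's reading (ii): at a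
  non-flat base the vanishing is NOT the reflection-symmetry consequence available at the flat configuration and stays
  a genuine binder of NE1′'s (β)/(γ) node — and the two ways a consumer may discharge or bypass it are RECORDED here,
  not located and not asserted: (i) `u₀` = the minimiser `U_k(V)` with `S`/`m u₀` the first variation of the k-th
  action, where `h0` is criticality (print places its backgrounds on the unique critical orbit of
  [Balaban1985Variational] Thm 1 p. 279 AS QUOTED in the tree modules `Setup`, `B11Thm1`, `B10NestedMinimizer` — a
  pointer to those quotations, nothing quoted or used here) — whoever supplies `h0` gets the suppression by
  `condMeanSuppression_of_base` (= `T4FirstOrderSize.condMeanSuppression_of_flat`, whose reference point is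
  arbitrary); (iii) first-order SMALLNESS instead of vanishing: the affine bound
  `‖m u b‖ ≤ ‖m u₀ b‖ + lip·dev u` (`norm_mean_le_base_add`, the triangle inequality), whose zeroth-order term the
  consumer absorbs in its own currency (`T4FirstOrderSize.InCurrency` / `LinearAbsorbed` type that alternative).

PRINTED LOCI (CONTEXT ONLY; quoted VERBATIM in the two imported modules' headers and cross-read there — this module
reads NO page and formalises NO printed statement): the chart [Balaban1987RG1] (CMP 109) p. 272 (3.10)/(3.11), the
direction window (3.13)/(3.14) p. 272 and the Cauchy estimate in the coefficient of the direction (3.15)–(3.17) p. 273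
(header of `T4DirectionChart`); the background's analytic extension [Balaban1989LargeFieldI] (CMP 122) Prop. 1
p. 194 with (1.78), p. 195 (1.79), p. 197 (1.83), and its proof [Balaban1989LargeFieldII] (CMP 122) p. 359 (header of
`T4BackgroundDeviation`).  The OBSERVATION behind the row (the cell's READING of two printed shapes, not a theorem
about Bałaban's objects): Prop. 1's complexified exterior «𝕍_k = V′_kV_k = exp iB′V_k … with B′ ∈ gᶜ and small» has
the shape of the chart (3.10) — a direction `B′` at the base `V_k` — so the background's slice and the conditional
mean's slice CAN be posed on one chart; whether Bałaban's `V_Λ(V_k⌈_{Z∩Λᶜ})` and his conditional means actually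
satisfy the hypotheses below on one class `𝒞` is NOT decided here.

NOT DISCHARGED / NOT CLAIMED, stated so that nobody reads more into the module: everything listed as NOT DISCHARGED in
`T4DirectionChart` ((1.12)/(1.13) for the moved configuration beyond (C1)/(C2); the `|𝐉| < γ₀` half of (1.14) and the
second/fourth members of (3.14); the tower condition; Gᶜ-covariance; the identification of `dirTube`/`𝒞`/`N u`/
`dev u`/the base with any printed space, norm or configuration; `MeanVanishes` at a non-flat base; analyticity of the
functions moved) and everything listed in `T4BackgroundDeviation` (existence, uniqueness, measurability, `FieldIndep`
of `V_Λ`; (1.78)/(1.83); the analytic extension itself; any value of `B_V`, `α₁′`; the ORBIT-versus-REPRESENTATIVE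
caveat DIVERGENCE D-pv04g10.1) stays undischarged; IN ADDITION, this module's own modelling hypotheses are:
(h1) that the background, as a function of the exterior, FACTORS through a functional `Vc` of the chart configuration
with the stated differentiability and bound on a class containing the tube's images (`hVdiff`, `hVB`, `hclass`, `hv`,
`hv₀` are HYPOTHESES — the located shape is Prop. 1's sentence, nothing more); (h2) that ONE class `𝒞` and ONE width
`α₁′` serve both functionals (a consumer holding two classes intersects them and takes the smaller width —
bookkeeping left to the instantiating seat); (h3) every k-dependence (of `B`, `B_V`, `α₁′`, `α₀`, `ξ`, the gauges `N`,
`dev`, the bond sets `s`, `S`, `plaq`) enters through a NAMED binder and is NOT estimated (T4-DAG D7 and the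
(LOG-SIZE)/(LOG-SIZE-REL) caveats stand).  Value = kernel bookkeeping merging the (α)/(γ) first-order inputs onto one
chart; NOT summit progress; NO statement about Bałaban's renormalization-group objects is asserted.

Depends on `T4DirectionChart` (`GUnit`, `basePlaqAt`, `covSumAt`, `dirTube`, `closedBall_subset_dirTube`,
`baseConfig`, `dirConfig`, `dirConfig_zero`, `dirConfig_eq_base_of_eq_zero`, `differentiable_dirConfig`,
`meanLipschitz_chart_of_class`, `condMeanSuppression_chart_of_class`), `T4BackgroundDeviation` (`BgDev`,
`bgDev_of_segment`, `bgDev_of_segment_SU`), `T4FirstOrderSize` (`MeanLipschitz`, `MeanVanishes`,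
`CondMeanSuppression`, `condMeanSuppression_of_flat`), `UnitaryModel` (`norm_of_mem_unitaryGroup`; the `U(n)`/`SU(n)`
`GaugeGroup` instances), `Setup` (`GaugeGroup.dist1_one`) and Mathlib (`Unitary.toUnits`, `Unitary.val_toUnits_apply`,
`map_inv`, `Subtype.ext`, `norm_add_le`).
-/

noncomputable section

namespace Literature.MathematicalPhysics.QuantumFieldTheory.Balaban1983to89.T4BackgroundDeviationChart

open Set Metric
open T4DirectionChart T4BackgroundDeviation

/-! ## §1  `BgDev` from the direction chart [bookkeeping] -/

section Chart

open scoped Matrix.Norms.L2Operator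

variable {ι : Type*} {𝔸 : Type*} [NormedRing 𝔸] [NormedAlgebra ℂ 𝔸] [CompleteSpace 𝔸]
variable {n : Type*} [Fintype n] [DecidableEq n] [Nonempty n]
variable {P : Params} {j : ℕ}

/-- `BgDev` FROM THE CHART, TUBE LEVEL (`U(n)`).  Data: the chart data of `T4DirectionChart.meanLipschitz_chart`
(G-valued base `U` with plaquette curvature `≤ δ_bξ²` on `plaq`, `δ_b ≤ α₀/2`; per exterior `u ∈ dom` a direction `A u`
with gauge `0 ≤ N u ≤ dev u`, `‖A u i‖ ≤ N u`, covariant plaquette sums `≤ 2ξ·N u`; `dev u + α₁′ ≤ α₀/8` and `≤ t`), and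
— the one ANALYTIC INPUT, a HYPOTHESIS — for `dev u > 0` and `b ∈ s` a matrix-valued slice `g` bounded by `B` and
complex differentiable ON THE TUBE `dirTube ξ α₀ α₁′ t plaq (A u) U (N u)` with endpoints the two backgrounds,
`g 0 = vΛ u₀ b` (the BASE) and `g 1 = vΛ u b`; configurations with `dev u = 0` carry the reference background on `s`.
Then `BgDev s vΛ dom u₀ dev (4B/α₁′)` — `T4BackgroundDeviation.bgDev_of_segment` with its disc inclusion supplied by
`T4DirectionChart.closedBall_subset_dirTube`.  Nothing printed is asserted. [folklore] -/
theorem bgDev_chart {s : Finset (PBond P j)}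
    {vΛ : GaugeField P j (Matrix.unitaryGroup n ℂ) → GaugeField P j (Matrix.unitaryGroup n ℂ)}
    {dom : Set (GaugeField P j (Matrix.unitaryGroup n ℂ))} {u₀ : GaugeField P j (Matrix.unitaryGroup n ℂ)}
    {dev N : GaugeField P j (Matrix.unitaryGroup n ℂ) → ℝ} {A : GaugeField P j (Matrix.unitaryGroup n ℂ) → ι → 𝔸}
    {U : ι → 𝔸ˣ} {plaq : Set (ι × ι × ι × ι)} {ξ α₀ α₁' t δb B : ℝ}
    (hξ0 : 0 < ξ) (hξ1 : ξ ≤ 1) (hα₀ : α₀ ≤ 1) (hα₁ : 0 < α₁') (hU : ∀ i, GUnit (U i))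
    (hbase : ∀ p ∈ plaq, ‖((basePlaqAt U p : 𝔸ˣ) : 𝔸) - 1‖ ≤ δb * ξ ^ 2) (hδb : δb ≤ α₀ / 2)
    (hdev : ∀ u ∈ dom, 0 ≤ dev u) (hN0 : ∀ u ∈ dom, 0 ≤ N u) (hN : ∀ u ∈ dom, N u ≤ dev u)
    (hA : ∀ u ∈ dom, ∀ i, ‖A u i‖ ≤ N u) (hcov : ∀ u ∈ dom, ∀ p ∈ plaq, ‖covSumAt (A u) U p‖ ≤ 2 * ξ * N u)
    (hsum : ∀ u ∈ dom, dev u + α₁' ≤ α₀ / 8) (ht : ∀ u ∈ dom, dev u + α₁' ≤ t)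
    (hleaf : ∀ u ∈ dom, 0 < dev u → ∀ b ∈ s, ∃ g : ℂ → Matrix n n ℂ,
      g 0 = (vΛ u₀ b : Matrix n n ℂ) ∧ g 1 = (vΛ u b : Matrix n n ℂ) ∧
      DifferentiableOn ℂ g (dirTube ξ α₀ α₁' t plaq (A u) U (N u)) ∧
      ∀ z ∈ dirTube ξ α₀ α₁' t plaq (A u) U (N u), ‖g z‖ ≤ B)
    (hflat : ∀ u ∈ dom, dev u = 0 → ∀ b ∈ s, vΛ u b = vΛ u₀ b) :
    BgDev s vΛ dom u₀ dev (4 * B / α₁') := by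
  refine bgDev_of_segment hα₁ hdev (fun u hu hpos b hb => ?_) hflat
  obtain ⟨g, hg0, hg1, hg, hB⟩ := hleaf u hu hpos b hb
  exact ⟨g, dirTube ξ α₀ α₁' t plaq (A u) U (N u), hg0, hg1, hg, hB, fun s₀ hs₀ =>
    closedBall_subset_dirTube hξ0 hξ1 hα₀ hα₁.le hpos (hN0 u hu) (hN u hu) hU (hA u hu) hbase hδb (hcov u hu)
      (hsum u hu) (ht u hu) hs₀⟩

/-- The same in `SU(n)` (`T4BackgroundDeviation.bgDev_of_segment_SU`). [folklore] -/
theorem bgDev_chart_SU {s : Finset (PBond P j)}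
    {vΛ : GaugeField P j (Matrix.specialUnitaryGroup n ℂ) → GaugeField P j (Matrix.specialUnitaryGroup n ℂ)}
    {dom : Set (GaugeField P j (Matrix.specialUnitaryGroup n ℂ))}
    {u₀ : GaugeField P j (Matrix.specialUnitaryGroup n ℂ)}
    {dev N : GaugeField P j (Matrix.specialUnitaryGroup n ℂ) → ℝ}
    {A : GaugeField P j (Matrix.specialUnitaryGroup n ℂ) → ι → 𝔸}
    {U : ι → 𝔸ˣ} {plaq : Set (ι × ι × ι × ι)} {ξ α₀ α₁' t δb B : ℝ}
    (hξ0 : 0 < ξ) (hξ1 : ξ ≤ 1) (hα₀ : α₀ ≤ 1) (hα₁ : 0 < α₁') (hU : ∀ i, GUnit (U i))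
    (hbase : ∀ p ∈ plaq, ‖((basePlaqAt U p : 𝔸ˣ) : 𝔸) - 1‖ ≤ δb * ξ ^ 2) (hδb : δb ≤ α₀ / 2)
    (hdev : ∀ u ∈ dom, 0 ≤ dev u) (hN0 : ∀ u ∈ dom, 0 ≤ N u) (hN : ∀ u ∈ dom, N u ≤ dev u)
    (hA : ∀ u ∈ dom, ∀ i, ‖A u i‖ ≤ N u) (hcov : ∀ u ∈ dom, ∀ p ∈ plaq, ‖covSumAt (A u) U p‖ ≤ 2 * ξ * N u)
    (hsum : ∀ u ∈ dom, dev u + α₁' ≤ α₀ / 8) (ht : ∀ u ∈ dom, dev u + α₁' ≤ t)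
    (hleaf : ∀ u ∈ dom, 0 < dev u → ∀ b ∈ s, ∃ g : ℂ → Matrix n n ℂ,
      g 0 = (vΛ u₀ b : Matrix n n ℂ) ∧ g 1 = (vΛ u b : Matrix n n ℂ) ∧
      DifferentiableOn ℂ g (dirTube ξ α₀ α₁' t plaq (A u) U (N u)) ∧
      ∀ z ∈ dirTube ξ α₀ α₁' t plaq (A u) U (N u), ‖g z‖ ≤ B)
    (hflat : ∀ u ∈ dom, dev u = 0 → ∀ b ∈ s, vΛ u b = vΛ u₀ b) :
    BgDev s vΛ dom u₀ dev (4 * B / α₁') := by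
  refine bgDev_of_segment_SU hα₁ hdev (fun u hu hpos b hb => ?_) hflat
  obtain ⟨g, hg0, hg1, hg, hB⟩ := hleaf u hu hpos b hb
  exact ⟨g, dirTube ξ α₀ α₁' t plaq (A u) U (N u), hg0, hg1, hg, hB, fun s₀ hs₀ =>
    closedBall_subset_dirTube hξ0 hξ1 hα₀ hα₁.le hpos (hN0 u hu) (hN u hu) hU (hA u hu) hbase hδb (hcov u hu)
      (hsum u hu) (ht u hu) hs₀⟩

/-- `BgDev` FROM THE CHART, CONFIGURATION LEVEL (`U(n)`).  Hypotheses beyond the chart data: a MATRIX-valued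
background functional `Vc` on link configurations of the (finite) bond set of the chart, complex differentiable (for
the bonds `b ∈ s`) and bounded by `B` on a set `𝒞` of configurations which CONTAINS every moved configuration
`dirConfig ξ (A u) U z` with `z` in the tube of `u` (the instantiating seat's reading of the printed regularity clauses
— a HYPOTHESIS), and the set-up `(vΛ u b : M_n(ℂ)) = Vc (dirConfig ξ (A u) U 1) b` (the exterior `u ∈ dom` IS the
chart point) and `(vΛ u₀ b : M_n(ℂ)) = Vc (baseConfig U) b` (the reference IS the base).  The case `dev u = 0` forces
`A u = 0` and needs no separate hypothesis.  Verbatim the background-deviation twin of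
`T4DirectionChart.meanLipschitz_chart_of_class`; nothing printed is asserted. [folklore] -/
theorem bgDev_chart_of_class [Fintype ι] {s : Finset (PBond P j)}
    {vΛ : GaugeField P j (Matrix.unitaryGroup n ℂ) → GaugeField P j (Matrix.unitaryGroup n ℂ)}
    {dom : Set (GaugeField P j (Matrix.unitaryGroup n ℂ))} {u₀ : GaugeField P j (Matrix.unitaryGroup n ℂ)}
    {dev N : GaugeField P j (Matrix.unitaryGroup n ℂ) → ℝ} {A : GaugeField P j (Matrix.unitaryGroup n ℂ) → ι → 𝔸}
    {U : ι → 𝔸ˣ} {plaq : Set (ι × ι × ι × ι)} {ξ α₀ α₁' t δb B : ℝ}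
    {𝒞 : Set (ι → 𝔸)} {Vc : (ι → 𝔸) → PBond P j → Matrix n n ℂ}
    (hξ0 : 0 < ξ) (hξ1 : ξ ≤ 1) (hα₀ : α₀ ≤ 1) (hα₁ : 0 < α₁') (hU : ∀ i, GUnit (U i))
    (hbase : ∀ p ∈ plaq, ‖((basePlaqAt U p : 𝔸ˣ) : 𝔸) - 1‖ ≤ δb * ξ ^ 2) (hδb : δb ≤ α₀ / 2)
    (hdev : ∀ u ∈ dom, 0 ≤ dev u) (hN0 : ∀ u ∈ dom, 0 ≤ N u) (hN : ∀ u ∈ dom, N u ≤ dev u)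
    (hA : ∀ u ∈ dom, ∀ i, ‖A u i‖ ≤ N u) (hcov : ∀ u ∈ dom, ∀ p ∈ plaq, ‖covSumAt (A u) U p‖ ≤ 2 * ξ * N u)
    (hsum : ∀ u ∈ dom, dev u + α₁' ≤ α₀ / 8) (ht : ∀ u ∈ dom, dev u + α₁' ≤ t)
    (hVdiff : ∀ b ∈ s, DifferentiableOn ℂ (fun W => Vc W b) 𝒞)
    (hVB : ∀ W ∈ 𝒞, ∀ b ∈ s, ‖Vc W b‖ ≤ B)
    (hclass : ∀ u ∈ dom, ∀ z ∈ dirTube ξ α₀ α₁' t plaq (A u) U (N u), dirConfig ξ (A u) U z ∈ 𝒞)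
    (hv : ∀ u ∈ dom, ∀ b ∈ s, (vΛ u b : Matrix n n ℂ) = Vc (dirConfig ξ (A u) U 1) b)
    (hv₀ : ∀ b ∈ s, (vΛ u₀ b : Matrix n n ℂ) = Vc (baseConfig U) b) :
    BgDev s vΛ dom u₀ dev (4 * B / α₁') := by
  refine bgDev_chart hξ0 hξ1 hα₀ hα₁ hU hbase hδb hdev hN0 hN hA hcov hsum ht ?_ ?_
  · intro u hu _ b hb
    refine ⟨fun z => Vc (dirConfig ξ (A u) U z) b, ?_, ?_, ?_, ?_⟩
    · simp only [dirConfig_zero]; exact (hv₀ b hb).symm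
    · exact (hv u hu b hb).symm
    · exact (hVdiff b hb).comp (differentiable_dirConfig ξ (A u) U).differentiableOn
        (fun z hz => hclass u hu z hz)
    · exact fun z hz => hVB _ (hclass u hu z hz) b hb
  · intro u hu h0 b hb
    have hN0' : N u = 0 := le_antisymm (h0 ▸ hN u hu) (hN0 u hu)
    have hA0 : ∀ i, A u i = 0 := fun i => norm_le_zero_iff.mp (hN0' ▸ hA u hu i)
    apply Subtype.ext
    rw [hv u hu b hb, dirConfig_eq_base_of_eq_zero ξ hA0, hv₀ b hb]

/-- The same in `SU(n)`. [folklore] -/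
theorem bgDev_chart_of_class_SU [Fintype ι] {s : Finset (PBond P j)}
    {vΛ : GaugeField P j (Matrix.specialUnitaryGroup n ℂ) → GaugeField P j (Matrix.specialUnitaryGroup n ℂ)}
    {dom : Set (GaugeField P j (Matrix.specialUnitaryGroup n ℂ))}
    {u₀ : GaugeField P j (Matrix.specialUnitaryGroup n ℂ)}
    {dev N : GaugeField P j (Matrix.specialUnitaryGroup n ℂ) → ℝ}
    {A : GaugeField P j (Matrix.specialUnitaryGroup n ℂ) → ι → 𝔸}
    {U : ι → 𝔸ˣ} {plaq : Set (ι × ι × ι × ι)} {ξ α₀ α₁' t δb B : ℝ}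
    {𝒞 : Set (ι → 𝔸)} {Vc : (ι → 𝔸) → PBond P j → Matrix n n ℂ}
    (hξ0 : 0 < ξ) (hξ1 : ξ ≤ 1) (hα₀ : α₀ ≤ 1) (hα₁ : 0 < α₁') (hU : ∀ i, GUnit (U i))
    (hbase : ∀ p ∈ plaq, ‖((basePlaqAt U p : 𝔸ˣ) : 𝔸) - 1‖ ≤ δb * ξ ^ 2) (hδb : δb ≤ α₀ / 2)
    (hdev : ∀ u ∈ dom, 0 ≤ dev u) (hN0 : ∀ u ∈ dom, 0 ≤ N u) (hN : ∀ u ∈ dom, N u ≤ dev u)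
    (hA : ∀ u ∈ dom, ∀ i, ‖A u i‖ ≤ N u) (hcov : ∀ u ∈ dom, ∀ p ∈ plaq, ‖covSumAt (A u) U p‖ ≤ 2 * ξ * N u)
    (hsum : ∀ u ∈ dom, dev u + α₁' ≤ α₀ / 8) (ht : ∀ u ∈ dom, dev u + α₁' ≤ t)
    (hVdiff : ∀ b ∈ s, DifferentiableOn ℂ (fun W => Vc W b) 𝒞)
    (hVB : ∀ W ∈ 𝒞, ∀ b ∈ s, ‖Vc W b‖ ≤ B)
    (hclass : ∀ u ∈ dom, ∀ z ∈ dirTube ξ α₀ α₁' t plaq (A u) U (N u), dirConfig ξ (A u) U z ∈ 𝒞)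
    (hv : ∀ u ∈ dom, ∀ b ∈ s, (vΛ u b : Matrix n n ℂ) = Vc (dirConfig ξ (A u) U 1) b)
    (hv₀ : ∀ b ∈ s, (vΛ u₀ b : Matrix n n ℂ) = Vc (baseConfig U) b) :
    BgDev s vΛ dom u₀ dev (4 * B / α₁') := by
  refine bgDev_chart_SU hξ0 hξ1 hα₀ hα₁ hU hbase hδb hdev hN0 hN hA hcov hsum ht ?_ ?_
  · intro u hu _ b hb
    refine ⟨fun z => Vc (dirConfig ξ (A u) U z) b, ?_, ?_, ?_, ?_⟩
    · simp only [dirConfig_zero]; exact (hv₀ b hb).symm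
    · exact (hv u hu b hb).symm
    · exact (hVdiff b hb).comp (differentiable_dirConfig ξ (A u) U).differentiableOn
        (fun z hz => hclass u hu z hz)
    · exact fun z hz => hVB _ (hclass u hu z hz) b hb
  · intro u hu h0 b hb
    have hN0' : N u = 0 := le_antisymm (h0 ▸ hN u hu) (hN0 u hu)
    have hA0 : ∀ i, A u i = 0 := fun i => norm_le_zero_iff.mp (hN0' ▸ hA u hu i)
    apply Subtype.ext
    rw [hv u hu b hb, dirConfig_eq_base_of_eq_zero ξ hA0, hv₀ b hb]

end Chart

/-! ## §2  One chart, both first-order inputs [bookkeeping] -/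

section Both

open scoped Matrix.Norms.L2Operator

variable {ι : Type*} {𝔸 : Type*} [NormedRing 𝔸] [NormedAlgebra ℂ 𝔸] [CompleteSpace 𝔸]
variable {n : Type*} [Fintype n] [DecidableEq n] [Nonempty n]
variable {P : Params} {j : ℕ}
variable {β F : Type*} [NormedAddCommGroup F] [NormedSpace ℂ F] [CompleteSpace F]

/-- ONE CHART, BOTH FIRST-ORDER INPUTS (`U(n)`).  The chart data of `T4DirectionChart.meanLipschitz_chart_of_class`
with TWO functionals on the SAME class `𝒞` ⊇ the chart images of the tubes — `Mc` (the insert's conditional mean,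
bounded by `B`; `m u b = Mc (dirConfig ξ (A u) U 1) b`, `m u₀ b = Mc (baseConfig U) b`) and `Vc` (the background,
matrix-valued, bounded by `B_V`; `vΛ u b = Vc (dirConfig ξ (A u) U 1) b`, `vΛ u₀ b = Vc (baseConfig U) b`) — give BOTH
the mean-field modulus `MeanLipschitz dom m S u₀ dev (4B/α₁′)` (the sibling, by name) AND the background-deviation input
`BgDev s vΛ dom u₀ dev (4B_V/α₁′)` (§1).  Every analytic input is a HYPOTHESIS; nothing printed is asserted.
[folklore] -/
theorem chart_supplies_both [Fintype ι] {s : Finset (PBond P j)} {S : Finset β}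
    {vΛ : GaugeField P j (Matrix.unitaryGroup n ℂ) → GaugeField P j (Matrix.unitaryGroup n ℂ)}
    {m : GaugeField P j (Matrix.unitaryGroup n ℂ) → β → F}
    {dom : Set (GaugeField P j (Matrix.unitaryGroup n ℂ))} {u₀ : GaugeField P j (Matrix.unitaryGroup n ℂ)}
    {dev N : GaugeField P j (Matrix.unitaryGroup n ℂ) → ℝ} {A : GaugeField P j (Matrix.unitaryGroup n ℂ) → ι → 𝔸}
    {U : ι → 𝔸ˣ} {plaq : Set (ι × ι × ι × ι)} {ξ α₀ α₁' t δb B BV : ℝ}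
    {𝒞 : Set (ι → 𝔸)} {Mc : (ι → 𝔸) → β → F} {Vc : (ι → 𝔸) → PBond P j → Matrix n n ℂ}
    (hξ0 : 0 < ξ) (hξ1 : ξ ≤ 1) (hα₀ : α₀ ≤ 1) (hα₁ : 0 < α₁') (hU : ∀ i, GUnit (U i))
    (hbase : ∀ p ∈ plaq, ‖((basePlaqAt U p : 𝔸ˣ) : 𝔸) - 1‖ ≤ δb * ξ ^ 2) (hδb : δb ≤ α₀ / 2)
    (hdev : ∀ u ∈ dom, 0 ≤ dev u) (hN0 : ∀ u ∈ dom, 0 ≤ N u) (hN : ∀ u ∈ dom, N u ≤ dev u)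
    (hA : ∀ u ∈ dom, ∀ i, ‖A u i‖ ≤ N u) (hcov : ∀ u ∈ dom, ∀ p ∈ plaq, ‖covSumAt (A u) U p‖ ≤ 2 * ξ * N u)
    (hsum : ∀ u ∈ dom, dev u + α₁' ≤ α₀ / 8) (ht : ∀ u ∈ dom, dev u + α₁' ≤ t)
    (hclass : ∀ u ∈ dom, ∀ z ∈ dirTube ξ α₀ α₁' t plaq (A u) U (N u), dirConfig ξ (A u) U z ∈ 𝒞)
    (hMdiff : ∀ b ∈ S, DifferentiableOn ℂ (fun W => Mc W b) 𝒞) (hMB : ∀ W ∈ 𝒞, ∀ b ∈ S, ‖Mc W b‖ ≤ B)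
    (hm : ∀ u ∈ dom, ∀ b ∈ S, m u b = Mc (dirConfig ξ (A u) U 1) b) (hm₀ : ∀ b ∈ S, m u₀ b = Mc (baseConfig U) b)
    (hVdiff : ∀ b ∈ s, DifferentiableOn ℂ (fun W => Vc W b) 𝒞) (hVB : ∀ W ∈ 𝒞, ∀ b ∈ s, ‖Vc W b‖ ≤ BV)
    (hv : ∀ u ∈ dom, ∀ b ∈ s, (vΛ u b : Matrix n n ℂ) = Vc (dirConfig ξ (A u) U 1) b)
    (hv₀ : ∀ b ∈ s, (vΛ u₀ b : Matrix n n ℂ) = Vc (baseConfig U) b) :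
    T4FirstOrderSize.MeanLipschitz dom m S u₀ dev (4 * B / α₁') ∧ BgDev s vΛ dom u₀ dev (4 * BV / α₁') :=
  ⟨meanLipschitz_chart_of_class hξ0 hξ1 hα₀ hα₁ hU hbase hδb hdev hN0 hN hA hcov hsum ht hMdiff hMB hclass hm hm₀,
    bgDev_chart_of_class hξ0 hξ1 hα₀ hα₁ hU hbase hδb hdev hN0 hN hA hcov hsum ht hVdiff hVB hclass hv hv₀⟩

/-- … and with `MeanVanishes S (m u₀)` AT THE BASE as an explicit NAMED HYPOTHESIS (T4-DAG §8 Q22, reading (ii): at a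
non-flat base this is a genuine binder, see §4) the conditional-mean suppression
`CondMeanSuppression dom m S dev (4B/α₁′)` comes with the same `BgDev` (`U(n)`). [folklore] -/
theorem chart_supplies_both_condMean [Fintype ι] {s : Finset (PBond P j)} {S : Finset β}
    {vΛ : GaugeField P j (Matrix.unitaryGroup n ℂ) → GaugeField P j (Matrix.unitaryGroup n ℂ)}
    {m : GaugeField P j (Matrix.unitaryGroup n ℂ) → β → F}
    {dom : Set (GaugeField P j (Matrix.unitaryGroup n ℂ))} {u₀ : GaugeField P j (Matrix.unitaryGroup n ℂ)}
    {dev N : GaugeField P j (Matrix.unitaryGroup n ℂ) → ℝ} {A : GaugeField P j (Matrix.unitaryGroup n ℂ) → ι → 𝔸}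
    {U : ι → 𝔸ˣ} {plaq : Set (ι × ι × ι × ι)} {ξ α₀ α₁' t δb B BV : ℝ}
    {𝒞 : Set (ι → 𝔸)} {Mc : (ι → 𝔸) → β → F} {Vc : (ι → 𝔸) → PBond P j → Matrix n n ℂ}
    (hξ0 : 0 < ξ) (hξ1 : ξ ≤ 1) (hα₀ : α₀ ≤ 1) (hα₁ : 0 < α₁') (hU : ∀ i, GUnit (U i))
    (hbase : ∀ p ∈ plaq, ‖((basePlaqAt U p : 𝔸ˣ) : 𝔸) - 1‖ ≤ δb * ξ ^ 2) (hδb : δb ≤ α₀ / 2)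
    (hdev : ∀ u ∈ dom, 0 ≤ dev u) (hN0 : ∀ u ∈ dom, 0 ≤ N u) (hN : ∀ u ∈ dom, N u ≤ dev u)
    (hA : ∀ u ∈ dom, ∀ i, ‖A u i‖ ≤ N u) (hcov : ∀ u ∈ dom, ∀ p ∈ plaq, ‖covSumAt (A u) U p‖ ≤ 2 * ξ * N u)
    (hsum : ∀ u ∈ dom, dev u + α₁' ≤ α₀ / 8) (ht : ∀ u ∈ dom, dev u + α₁' ≤ t)
    (hclass : ∀ u ∈ dom, ∀ z ∈ dirTube ξ α₀ α₁' t plaq (A u) U (N u), dirConfig ξ (A u) U z ∈ 𝒞)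
    (h0 : T4FirstOrderSize.MeanVanishes S (m u₀))
    (hMdiff : ∀ b ∈ S, DifferentiableOn ℂ (fun W => Mc W b) 𝒞) (hMB : ∀ W ∈ 𝒞, ∀ b ∈ S, ‖Mc W b‖ ≤ B)
    (hm : ∀ u ∈ dom, ∀ b ∈ S, m u b = Mc (dirConfig ξ (A u) U 1) b) (hm₀ : ∀ b ∈ S, m u₀ b = Mc (baseConfig U) b)
    (hVdiff : ∀ b ∈ s, DifferentiableOn ℂ (fun W => Vc W b) 𝒞) (hVB : ∀ W ∈ 𝒞, ∀ b ∈ s, ‖Vc W b‖ ≤ BV)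
    (hv : ∀ u ∈ dom, ∀ b ∈ s, (vΛ u b : Matrix n n ℂ) = Vc (dirConfig ξ (A u) U 1) b)
    (hv₀ : ∀ b ∈ s, (vΛ u₀ b : Matrix n n ℂ) = Vc (baseConfig U) b) :
    T4FirstOrderSize.CondMeanSuppression dom m S dev (4 * B / α₁') ∧ BgDev s vΛ dom u₀ dev (4 * BV / α₁') :=
  ⟨condMeanSuppression_chart_of_class hξ0 hξ1 hα₀ hα₁ hU hbase hδb hdev hN0 hN hA hcov hsum ht h0 hMdiff hMB hclass
      hm hm₀,
    bgDev_chart_of_class hξ0 hξ1 hα₀ hα₁ hU hbase hδb hdev hN0 hN hA hcov hsum ht hVdiff hVB hclass hv hv₀⟩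

/-- ONE CHART, BOTH FIRST-ORDER INPUTS, `SU(n)`. [folklore] -/
theorem chart_supplies_both_SU [Fintype ι] {s : Finset (PBond P j)} {S : Finset β}
    {vΛ : GaugeField P j (Matrix.specialUnitaryGroup n ℂ) → GaugeField P j (Matrix.specialUnitaryGroup n ℂ)}
    {m : GaugeField P j (Matrix.specialUnitaryGroup n ℂ) → β → F}
    {dom : Set (GaugeField P j (Matrix.specialUnitaryGroup n ℂ))}
    {u₀ : GaugeField P j (Matrix.specialUnitaryGroup n ℂ)}
    {dev N : GaugeField P j (Matrix.specialUnitaryGroup n ℂ) → ℝ}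
    {A : GaugeField P j (Matrix.specialUnitaryGroup n ℂ) → ι → 𝔸}
    {U : ι → 𝔸ˣ} {plaq : Set (ι × ι × ι × ι)} {ξ α₀ α₁' t δb B BV : ℝ}
    {𝒞 : Set (ι → 𝔸)} {Mc : (ι → 𝔸) → β → F} {Vc : (ι → 𝔸) → PBond P j → Matrix n n ℂ}
    (hξ0 : 0 < ξ) (hξ1 : ξ ≤ 1) (hα₀ : α₀ ≤ 1) (hα₁ : 0 < α₁') (hU : ∀ i, GUnit (U i))
    (hbase : ∀ p ∈ plaq, ‖((basePlaqAt U p : 𝔸ˣ) : 𝔸) - 1‖ ≤ δb * ξ ^ 2) (hδb : δb ≤ α₀ / 2)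
    (hdev : ∀ u ∈ dom, 0 ≤ dev u) (hN0 : ∀ u ∈ dom, 0 ≤ N u) (hN : ∀ u ∈ dom, N u ≤ dev u)
    (hA : ∀ u ∈ dom, ∀ i, ‖A u i‖ ≤ N u) (hcov : ∀ u ∈ dom, ∀ p ∈ plaq, ‖covSumAt (A u) U p‖ ≤ 2 * ξ * N u)
    (hsum : ∀ u ∈ dom, dev u + α₁' ≤ α₀ / 8) (ht : ∀ u ∈ dom, dev u + α₁' ≤ t)
    (hclass : ∀ u ∈ dom, ∀ z ∈ dirTube ξ α₀ α₁' t plaq (A u) U (N u), dirConfig ξ (A u) U z ∈ 𝒞)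
    (hMdiff : ∀ b ∈ S, DifferentiableOn ℂ (fun W => Mc W b) 𝒞) (hMB : ∀ W ∈ 𝒞, ∀ b ∈ S, ‖Mc W b‖ ≤ B)
    (hm : ∀ u ∈ dom, ∀ b ∈ S, m u b = Mc (dirConfig ξ (A u) U 1) b) (hm₀ : ∀ b ∈ S, m u₀ b = Mc (baseConfig U) b)
    (hVdiff : ∀ b ∈ s, DifferentiableOn ℂ (fun W => Vc W b) 𝒞) (hVB : ∀ W ∈ 𝒞, ∀ b ∈ s, ‖Vc W b‖ ≤ BV)
    (hv : ∀ u ∈ dom, ∀ b ∈ s, (vΛ u b : Matrix n n ℂ) = Vc (dirConfig ξ (A u) U 1) b)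
    (hv₀ : ∀ b ∈ s, (vΛ u₀ b : Matrix n n ℂ) = Vc (baseConfig U) b) :
    T4FirstOrderSize.MeanLipschitz dom m S u₀ dev (4 * B / α₁') ∧ BgDev s vΛ dom u₀ dev (4 * BV / α₁') :=
  ⟨meanLipschitz_chart_of_class hξ0 hξ1 hα₀ hα₁ hU hbase hδb hdev hN0 hN hA hcov hsum ht hMdiff hMB hclass hm hm₀,
    bgDev_chart_of_class_SU hξ0 hξ1 hα₀ hα₁ hU hbase hδb hdev hN0 hN hA hcov hsum ht hVdiff hVB hclass hv hv₀⟩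

/-- … with `MeanVanishes` at the base as a NAMED HYPOTHESIS, `SU(n)`. [folklore] -/
theorem chart_supplies_both_condMean_SU [Fintype ι] {s : Finset (PBond P j)} {S : Finset β}
    {vΛ : GaugeField P j (Matrix.specialUnitaryGroup n ℂ) → GaugeField P j (Matrix.specialUnitaryGroup n ℂ)}
    {m : GaugeField P j (Matrix.specialUnitaryGroup n ℂ) → β → F}
    {dom : Set (GaugeField P j (Matrix.specialUnitaryGroup n ℂ))}
    {u₀ : GaugeField P j (Matrix.specialUnitaryGroup n ℂ)}
    {dev N : GaugeField P j (Matrix.specialUnitaryGroup n ℂ) → ℝ}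
    {A : GaugeField P j (Matrix.specialUnitaryGroup n ℂ) → ι → 𝔸}
    {U : ι → 𝔸ˣ} {plaq : Set (ι × ι × ι × ι)} {ξ α₀ α₁' t δb B BV : ℝ}
    {𝒞 : Set (ι → 𝔸)} {Mc : (ι → 𝔸) → β → F} {Vc : (ι → 𝔸) → PBond P j → Matrix n n ℂ}
    (hξ0 : 0 < ξ) (hξ1 : ξ ≤ 1) (hα₀ : α₀ ≤ 1) (hα₁ : 0 < α₁') (hU : ∀ i, GUnit (U i))
    (hbase : ∀ p ∈ plaq, ‖((basePlaqAt U p : 𝔸ˣ) : 𝔸) - 1‖ ≤ δb * ξ ^ 2) (hδb : δb ≤ α₀ / 2)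
    (hdev : ∀ u ∈ dom, 0 ≤ dev u) (hN0 : ∀ u ∈ dom, 0 ≤ N u) (hN : ∀ u ∈ dom, N u ≤ dev u)
    (hA : ∀ u ∈ dom, ∀ i, ‖A u i‖ ≤ N u) (hcov : ∀ u ∈ dom, ∀ p ∈ plaq, ‖covSumAt (A u) U p‖ ≤ 2 * ξ * N u)
    (hsum : ∀ u ∈ dom, dev u + α₁' ≤ α₀ / 8) (ht : ∀ u ∈ dom, dev u + α₁' ≤ t)
    (hclass : ∀ u ∈ dom, ∀ z ∈ dirTube ξ α₀ α₁' t plaq (A u) U (N u), dirConfig ξ (A u) U z ∈ 𝒞)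
    (h0 : T4FirstOrderSize.MeanVanishes S (m u₀))
    (hMdiff : ∀ b ∈ S, DifferentiableOn ℂ (fun W => Mc W b) 𝒞) (hMB : ∀ W ∈ 𝒞, ∀ b ∈ S, ‖Mc W b‖ ≤ B)
    (hm : ∀ u ∈ dom, ∀ b ∈ S, m u b = Mc (dirConfig ξ (A u) U 1) b) (hm₀ : ∀ b ∈ S, m u₀ b = Mc (baseConfig U) b)
    (hVdiff : ∀ b ∈ s, DifferentiableOn ℂ (fun W => Vc W b) 𝒞) (hVB : ∀ W ∈ 𝒞, ∀ b ∈ s, ‖Vc W b‖ ≤ BV)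
    (hv : ∀ u ∈ dom, ∀ b ∈ s, (vΛ u b : Matrix n n ℂ) = Vc (dirConfig ξ (A u) U 1) b)
    (hv₀ : ∀ b ∈ s, (vΛ u₀ b : Matrix n n ℂ) = Vc (baseConfig U) b) :
    T4FirstOrderSize.CondMeanSuppression dom m S dev (4 * B / α₁') ∧ BgDev s vΛ dom u₀ dev (4 * BV / α₁') :=
  ⟨condMeanSuppression_chart_of_class hξ0 hξ1 hα₀ hα₁ hU hbase hδb hdev hN0 hN hA hcov hsum ht h0 hMdiff hMB hclass
      hm hm₀,
    bgDev_chart_of_class_SU hξ0 hξ1 hα₀ hα₁ hU hbase hδb hdev hN0 hN hA hcov hsum ht hVdiff hVB hclass hv hv₀⟩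

end Both

/-! ## §3  The dictionary for a unitary base [folklore] -/

section Dictionary

open scoped Matrix.Norms.L2Operator

variable {n : Type*} [Fintype n] [DecidableEq n]

/-- A unitary matrix, read as a unit of `M_n(ℂ)` (L²-operator norm) through `Unitary.toUnits`, is a G-VALUED UNIT of
the chart: `‖u‖ ≤ 1` and `‖u⁻¹‖ ≤ 1` (both norms are `1`). [folklore] -/
theorem gUnit_toUnits [Nonempty n] (g : Matrix.unitaryGroup n ℂ) :
    GUnit (Unitary.toUnits g : (Matrix n n ℂ)ˣ) := by
  refine ⟨?_, ?_⟩
  · rw [Unitary.val_toUnits_apply]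
    exact (UnitaryModel.norm_of_mem_unitaryGroup g.2).le
  · rw [← map_inv, Unitary.val_toUnits_apply]
    exact (UnitaryModel.norm_of_mem_unitaryGroup (g⁻¹).2).le

/-- The same for a special unitary matrix (read in `U(n)` through the inclusion `SU(n) ≤ U(n)`). [folklore] -/
theorem gUnit_toUnits_SU [Nonempty n] (g : Matrix.specialUnitaryGroup n ℂ) :
    GUnit (Unitary.toUnits (⟨(g : Matrix n n ℂ), g.2.1⟩ : Matrix.unitaryGroup n ℂ) : (Matrix n n ℂ)ˣ) :=
  gUnit_toUnits _

/-- The base configuration of a family of unitary matrices read as units IS the underlying matrix configuration.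
[folklore] -/
theorem baseConfig_toUnits {ι : Type*} (W : ι → Matrix.unitaryGroup n ℂ) :
    baseConfig (fun i => (Unitary.toUnits (W i) : (Matrix n n ℂ)ˣ)) = fun i => (W i : Matrix n n ℂ) := by
  funext i
  simp only [baseConfig, Unitary.val_toUnits_apply]

/-- Hence a unitary base discharges the chart's `hU`: every bond of the base is a G-valued unit. [folklore] -/
theorem gUnit_base [Nonempty n] {ι : Type*} (W : ι → Matrix.unitaryGroup n ℂ) (i : ι) :
    GUnit ((fun i => (Unitary.toUnits (W i) : (Matrix n n ℂ)ˣ)) i) :=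
  gUnit_toUnits (W i)

end Dictionary

/-! ## §4  The base hypothesis, stated (T4-DAG v14 §8 Q22) [folklore] -/

section Base

variable {P : Params} {j : ℕ} {G : Type*} [GaugeGroup G]

/-- THE ZEROTH-ORDER TERM OF `BgDev` VANISHES IDENTICALLY: at the reference exterior the letter is
`dist1((vΛ u₀ b)⁻¹·vΛ u₀ b) = dist1 1 = 0` — the background-deviation input is relative by construction and needs NO
hypothesis at the base (none of Q22 (i)–(iii)), flat or not. [folklore] -/
theorem dist1_base_term (vΛ : GaugeField P j G → GaugeField P j G) (u₀ : GaugeField P j G) (b : PBond P j) :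
    dist1 ((vΛ u₀ b)⁻¹ * vΛ u₀ b) = 0 := by
  rw [inv_mul_cancel, GaugeGroup.dist1_one]

/-- Consequently `BgDev` restricted to the reference alone holds with ANY constant `L` as soon as `0 ≤ L·dev u₀`
(in particular with `L = 0` when `dev u₀ = 0`). [folklore] -/
theorem bgDev_singleton_base {s : Finset (PBond P j)} (vΛ : GaugeField P j G → GaugeField P j G)
    (u₀ : GaugeField P j G) (dev : GaugeField P j G → ℝ) {L : ℝ} (hL : 0 ≤ L * dev u₀) :
    BgDev s vΛ {u₀} u₀ dev L := by
  intro u hu b _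
  rw [Set.mem_singleton_iff.mp hu, dist1_base_term]
  exact hL

variable {𝒰 β E : Type*} [NormedAddCommGroup E]

/-- Q22 READING (iii), TYPED: first-order SMALLNESS instead of vanishing at the base.  Under the mean-field modulus
alone (no `MeanVanishes`), `‖m u b‖ ≤ ‖m u₀ b‖ + lip·dev u` on `dom × S` — the zeroth-order term `‖m u₀ b‖` is what a
consumer taking route (iii) absorbs in its own currency. [folklore] -/
theorem norm_mean_le_base_add {dom : Set 𝒰} {m : 𝒰 → β → E} {S : Finset β} {u₀ : 𝒰} {dev : 𝒰 → ℝ} {lip : ℝ}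
    (hL : T4FirstOrderSize.MeanLipschitz dom m S u₀ dev lip) {u : 𝒰} (hu : u ∈ dom) {b : β} (hb : b ∈ S) :
    ‖m u b‖ ≤ ‖m u₀ b‖ + lip * dev u :=
  calc ‖m u b‖ = ‖m u₀ b + (m u b - m u₀ b)‖ := by rw [add_sub_cancel]
    _ ≤ ‖m u₀ b‖ + ‖m u b - m u₀ b‖ := norm_add_le _ _
    _ ≤ ‖m u₀ b‖ + lip * dev u := add_le_add le_rfl (hL u hu b hb)

/-- Q22 READING (ii)/(i), TYPED AS THE IMPLICATION IT IS: whoever supplies `MeanVanishes S (m u₀)` at the (possibly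
non-flat) base — by criticality (i) or otherwise — turns the modulus into the suppression; this is
`T4FirstOrderSize.condMeanSuppression_of_flat`, whose reference point is arbitrary, re-exported under the name the row
uses. [folklore] -/
theorem condMeanSuppression_of_base {dom : Set 𝒰} {m : 𝒰 → β → E} {S : Finset β} {u₀ : 𝒰} {dev : 𝒰 → ℝ}
    {lip : ℝ} (h0 : T4FirstOrderSize.MeanVanishes S (m u₀))
    (hL : T4FirstOrderSize.MeanLipschitz dom m S u₀ dev lip) :
    T4FirstOrderSize.CondMeanSuppression dom m S dev lip :=
  T4FirstOrderSize.condMeanSuppression_of_flat h0 hL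

end Base

end Literature.MathematicalPhysics.QuantumFieldTheory.Balaban1983to89.T4BackgroundDeviationChart
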